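import Summits.RiemannHypothesis.RiemannHypothesis.Theorems.LiPrimeEchoDefs
import HarnessLib

/-!
# RiemannHypothesis / LiPrimeEcho — Assembly support C: the POLAR piece of the right edge is `O(1)` (RH-FREE)

RH-FREE [rh-li-prover].  Route `Theses/LiPrimeEcho.lean` (rung «Li PRIME-ECHO LAW» `LiTheory.LiZeroWindowEcho`, L-P(P1e);
cell `pub/rh-li`, theory memo `theory/TARGETS.md` §7.10 step C / §12), the registered skeleton statement
`LiPolarEdgeBound` of the item `Assembly` (stmt-RiemannHypothesis-19249, birth stub `stub_polar_bound`):

  for every `c ≥ 1` there is `C` with `|liPolarEdge n T₁ T₂| ≤ C` whenever `1 ≤ n`, `√n ≤ T₁ ≤ T₂ ≤ c√n + 1`.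

Here `liPolarEdge n T₁ T₂ = (1/π) Re ∫_{T₁}^{T₂} (1/w + 1/(w − 1)) k_n(w) dy`, `w = 3/2 + iy`,
`k_n(w) = F_n(w) + F_n(1 − w)`, `F_n(s) = (1 − 1/s)ⁿ`.  Proof: on the edge `|1/w + 1/(w − 1)| ≤ 2/y`,
`|F_n(w)| = (|w − 1|/|w|)ⁿ ≤ 1` and `|F_n(1 − w)| = (|w|/|w − 1|)ⁿ = (1 + 2/(¼ + y²))^{n/2} ≤ e` for `y² ≥ n`; the window
has length `≤ (c − 1)√n + 1`, so `C = 2(1 + e)c` serves (`intervalIntegral.norm_integral_le_of_norm_le_const`).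
An elementary estimate; nothing here bears on the truth of RH.
-/

noncomputable section

-- D-0017: `Summit.<S>.<S>.…` is the designed namespace of a single-problem summit.
set_option linter.dupNamespace false

open Complex MeasureTheory intervalIntegral Set
open scoped Interval

namespace Summit.RiemannHypothesis.RiemannHypothesis.Theorems.LiTheory

namespace PolarEdge

/-- `‖3/2 + iy‖ ≥ y` and `‖1/2 + iy‖ ≥ y` give `‖1/w + 1/(w − 1)‖ ≤ 2/y` on the right edge (`y > 0`). -/
theorem norm_polar_le {y : ℝ} (hy : 0 < y) :
    ‖1 / liRightPt y + 1 / (liRightPt y - 1)‖ ≤ 2 / y := by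
  have hw : y ≤ ‖liRightPt y‖ := by
    have := Complex.abs_im_le_norm (liRightPt y)
    simpa [liRightPt, abs_of_pos hy] using this
  have hw1 : y ≤ ‖liRightPt y - 1‖ := by
    have := Complex.abs_im_le_norm (liRightPt y - 1)
    simpa [liRightPt, abs_of_pos hy] using this
  have h1 : ‖1 / liRightPt y‖ ≤ 1 / y := by
    rw [norm_div, norm_one]; exact one_div_le_one_div_of_le hy hw
  have h2 : ‖1 / (liRightPt y - 1)‖ ≤ 1 / y := by
    rw [norm_div, norm_one]; exact one_div_le_one_div_of_le hy hw1
  calc ‖1 / liRightPt y + 1 / (liRightPt y - 1)‖ ≤ ‖1 / liRightPt y‖ + ‖1 / (liRightPt y - 1)‖ := norm_add_le _ _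
    _ ≤ 1 / y + 1 / y := add_le_add h1 h2
    _ = 2 / y := by ring

/-- `|F_n(3/2 + iy)| ≤ 1`: `|1 − 1/w|² = (¼ + y²)/(9/4 + y²) ≤ 1`. -/
theorem norm_liWeight_rightPt_le (n : ℕ) (y : ℝ) : ‖liWeight n (liRightPt y)‖ ≤ 1 := by
  unfold liWeight
  rw [norm_pow]
  refine pow_le_one₀ (norm_nonneg _) ?_
  have hw0 : liRightPt y ≠ 0 := by
    intro h; have := congrArg Complex.re h; simp [liRightPt] at this
  have hq : 1 - 1 / liRightPt y = (liRightPt y - 1) / liRightPt y := by field_simp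
  rw [hq, norm_div, div_le_one (norm_pos_iff.2 hw0)]
  have h1 : ‖liRightPt y - 1‖ ^ 2 ≤ ‖liRightPt y‖ ^ 2 := by
    rw [Complex.sq_norm, Complex.sq_norm, Complex.normSq_apply, Complex.normSq_apply]
    simp [liRightPt]
    nlinarith
  exact (pow_le_pow_iff_left₀ (norm_nonneg _) (norm_nonneg _) two_ne_zero).1 h1

/-- `|F_n(1 − (3/2 + iy))| ≤ e` for `y² ≥ n`: `1 − 1/(1 − w) = w/(w − 1)`, `|w/(w − 1)|² = 1 + 2/(¼ + y²) ≤ 1 + 2/n`,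
and `(1 + 2/n)ⁿ ≤ e²`. -/
theorem norm_liWeight_one_sub_rightPt_le (n : ℕ) {y : ℝ} (hy : 0 < y) (hyn : (n : ℝ) ≤ y ^ 2) :
    ‖liWeight n (1 - liRightPt y)‖ ≤ Real.exp 1 := by
  unfold liWeight
  rw [norm_pow]
  set w := liRightPt y with hw
  have hw1 : w - 1 ≠ 0 := by
    intro h; have := congrArg Complex.im h; simp [hw, liRightPt] at this; exact hy.ne' this
  have h1w : (1 : ℂ) - w ≠ 0 := by
    intro h; apply hw1; rw [← neg_sub, h, neg_zero]
  have hq : 1 - 1 / (1 - w) = w / (w - 1) := by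
    field_simp
    ring
  rw [hq]
  set q : ℝ := ‖w / (w - 1)‖ with hq'
  have hq0 : 0 ≤ q := norm_nonneg _
  -- `q² = (9/4 + y²)/(1/4 + y²) ≤ 1 + 2/y²`
  have hnum : ‖w‖ ^ 2 = 9 / 4 + y ^ 2 := by
    rw [Complex.sq_norm, Complex.normSq_apply]; simp [hw, liRightPt]; ring
  have hden : ‖w - 1‖ ^ 2 = 1 / 4 + y ^ 2 := by
    rw [Complex.sq_norm, Complex.normSq_apply]; simp [hw, liRightPt]; ring
  have hq2 : q ^ 2 = (9 / 4 + y ^ 2) / (1 / 4 + y ^ 2) := by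
    rw [hq', norm_div, div_pow, hnum, hden]
  rcases Nat.eq_zero_or_pos n with hn | hn
  · subst hn; simp [Real.one_le_exp_iff.2 zero_le_one]
  have hn0 : (0 : ℝ) < n := by exact_mod_cast hn
  have hq2le : q ^ 2 ≤ 1 + 2 / n := by
    rw [hq2, div_le_iff₀ (by positivity)]
    have h2n : 2 ≤ 2 / (n : ℝ) * (1 / 4 + y ^ 2) := by
      rw [div_mul_eq_mul_div, le_div_iff₀ hn0]
      nlinarith
    nlinarith
  -- `(q²)ⁿ ≤ (1 + 2/n)ⁿ ≤ exp(2/n)ⁿ = e²`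
  have hexp : (1 + 2 / (n : ℝ)) ≤ Real.exp (2 / n) := by
    have := Real.add_one_le_exp (2 / (n : ℝ)); linarith
  have hpow : (q ^ 2) ^ n ≤ Real.exp 1 ^ 2 := by
    calc (q ^ 2) ^ n ≤ (1 + 2 / (n : ℝ)) ^ n := pow_le_pow_left₀ (sq_nonneg _) hq2le n
      _ ≤ Real.exp (2 / n) ^ n := pow_le_pow_left₀ (by positivity) hexp n
      _ = Real.exp 2 := by rw [← Real.exp_nat_mul]; congr 1; field_simp
      _ = Real.exp 1 ^ 2 := by rw [← Real.exp_nat_mul]; norm_num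
  have hsq : (q ^ n) ^ 2 ≤ Real.exp 1 ^ 2 := by rw [← pow_mul, mul_comm, pow_mul]; exact hpow
  exact (pow_le_pow_iff_left₀ (pow_nonneg hq0 n) (Real.exp_pos 1).le two_ne_zero).1 hsq

/-- On the right edge above height `√n`: `‖(1/w + 1/(w − 1)) k_n(w)‖ ≤ (2/y)(1 + e)`. -/
theorem norm_polar_integrand_le (n : ℕ) {y : ℝ} (hy : 0 < y) (hyn : (n : ℝ) ≤ y ^ 2) :
    ‖(1 / liRightPt y + 1 / (liRightPt y - 1)) * liSymWeight n (liRightPt y)‖ ≤ 2 / y * (1 + Real.exp 1) := by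
  rw [norm_mul]
  have hk : ‖liSymWeight n (liRightPt y)‖ ≤ 1 + Real.exp 1 := by
    unfold liSymWeight
    exact (norm_add_le _ _).trans (add_le_add (norm_liWeight_rightPt_le n y)
      (norm_liWeight_one_sub_rightPt_le n hy hyn))
  exact mul_le_mul (norm_polar_le hy) hk (norm_nonneg _) (by positivity)

end PolarEdge

open PolarEdge in
/-- **Assembly support C of route `LiPrimeEcho` (`LiPolarEdgeBound`, birth stub `stub_polar_bound`; RH-FREE):**
for every `c ≥ 1` there is `C` (here `C = 2(1 + e)c`) such that `|liPolarEdge n T₁ T₂| ≤ C` whenever `1 ≤ n` and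
`√n ≤ T₁ ≤ T₂ ≤ c√n + 1`.  Verbatim the registered skeleton statement. -/
theorem liPolarEdgeBound :
    ∀ c : ℝ, 1 ≤ c → ∃ C : ℝ, ∀ n : ℕ, 1 ≤ n → ∀ T₁ T₂ : ℝ, Real.sqrt n ≤ T₁ → T₁ ≤ T₂ →
      T₂ ≤ c * Real.sqrt n + 1 → |liPolarEdge n T₁ T₂| ≤ C := by
  intro c hc
  refine ⟨2 * (1 + Real.exp 1) * c, fun n hn T₁ T₂ hT₁ hT₁₂ hT₂ ↦ ?_⟩
  have hn1 : (1 : ℝ) ≤ n := by exact_mod_cast hn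
  set s := Real.sqrt n with hs
  have hs1 : 1 ≤ s := by rw [hs]; exact Real.one_le_sqrt.2 hn1
  have hs0 : 0 < s := by linarith
  have hss : s ^ 2 = n := by rw [hs, Real.sq_sqrt (by linarith)]
  have he := Real.exp_pos 1
  -- pointwise bound on `Ι T₁ T₂ = Ioc T₁ T₂`
  have hpt : ∀ y ∈ Ι T₁ T₂, ‖(1 / liRightPt y + 1 / (liRightPt y - 1)) * liSymWeight n (liRightPt y)‖ ≤
      2 / s * (1 + Real.exp 1) := by
    intro y hy
    rw [uIoc_of_le hT₁₂] at hy
    have hy1 : s ≤ y := hT₁.trans hy.1.le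
    have hy0 : 0 < y := hs0.trans_le hy1
    have hyn : (n : ℝ) ≤ y ^ 2 := by rw [← hss]; exact pow_le_pow_left₀ hs0.le hy1 2
    refine (norm_polar_integrand_le n hy0 hyn).trans ?_
    gcongr
  have hI := intervalIntegral.norm_integral_le_of_norm_le_const hpt
  rw [abs_of_nonneg (by linarith : (0 : ℝ) ≤ T₂ - T₁)] at hI
  have hlen : T₂ - T₁ ≤ (c - 1) * s + 1 := by linarith
  have hπ : 1 / Real.pi ≤ 1 := by
    rw [div_le_one Real.pi_pos]; linarith [Real.pi_gt_three]
  unfold liPolarEdge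
  rw [abs_mul, abs_of_pos (by positivity : (0 : ℝ) < 1 / Real.pi)]
  have hre := (Complex.abs_re_le_norm
    (∫ y in T₁..T₂, (1 / liRightPt y + 1 / (liRightPt y - 1)) * liSymWeight n (liRightPt y)))
  have hmain : ‖∫ y in T₁..T₂, (1 / liRightPt y + 1 / (liRightPt y - 1)) * liSymWeight n (liRightPt y)‖ ≤
      2 * (1 + Real.exp 1) * c := by
    refine hI.trans ?_
    calc 2 / s * (1 + Real.exp 1) * (T₂ - T₁) ≤ 2 / s * (1 + Real.exp 1) * ((c - 1) * s + 1) := by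
          gcongr
      _ = 2 * (1 + Real.exp 1) * ((c - 1) + 1 / s) := by field_simp
      _ ≤ 2 * (1 + Real.exp 1) * ((c - 1) + 1) := by
          gcongr
          rw [div_le_one hs0]; exact hs1
      _ = 2 * (1 + Real.exp 1) * c := by ring
  calc 1 / Real.pi * |(∫ y in T₁..T₂, (1 / liRightPt y + 1 / (liRightPt y - 1)) * liSymWeight n (liRightPt y)).re|
      ≤ 1 * (2 * (1 + Real.exp 1) * c) := mul_le_mul hπ (hre.trans hmain) (abs_nonneg _) zero_le_one
    _ = 2 * (1 + Real.exp 1) * c := one_mul _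

end Summit.RiemannHypothesis.RiemannHypothesis.Theorems.LiTheory

end
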